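import Summits.KontsevichZagierPeriods.KontsevichZagierPeriods.Theses.InequalityCost

/-!
# `TameFormsSuffice` (stmt-KontsevichZagierPeriods-8990, route InequalityCost, rank 5) — birth skeleton

Crux (route decl, fixed): `TameFormsSuffice : TameVolumeKernel → KontsevichZagierPeriods` — Conjecture 1
for TAME VOLUME FORMS (two `ℚ`-semialgebraic representations of one dimension, domains in a box
`[-N, N]ⁿ`, integrand `1` on the domain, equal value ⇒ `KZ.Equivalent`) already implies Conjecture 1
for all representations of KZ's literal shape.

Line `birth` = the route's own plan for this crux: Viu-Sos' SEMI-CANONICAL REDUCTION run INSIDE the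
rules (arXiv:1509.01097 = Viusos2020: Thm 2.1 / Cor 2.1 compact domains; Prop 2.2 / Cor 2.2
separation of the boundary poles by embedded resolution, Hironaka1964, BelkaleBrosnan2003; Cor 2.3 the
graph trick to volumes; §4 gluing of translates), cut at its printed seams into four NAMED stubs, each
an unconditional statement about the calculus `Literature.NumberTheory.Transcendental.KZCalculus`
(no stub mentions `TameVolumeKernel` or the summit; the kernel hypothesis is consumed exactly once, in
the sorry-free composition):

* `stub_compactDomain` (Viusos2020 Thm 2.1 / Cor 2.1 as a KZ-equivalence; size M–L): every integral
  representation is `KZ.Equivalent` to one (possibly in another dimension) whose DOMAIN lies in a box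
  `[-N, N]ᵐ` — decompose `ℝⁿ` by the projective cube charts `C_i` (domain additivity, null walls
  `{xᵢ = ±xⱼ}`), invert the unbounded charts (`xᵢ ↦ 1/xᵢ`, a `ℚ`-semialgebraic injective change of
  variables with rational Jacobian), merge the bounded pieces (slabs at disjoint levels + gluing, tree
  `KZ.IntegralRep.slab/glue`). Why it might fail: only bookkeeping risk (null overlaps of the closed
  charts; merging must keep the box bound) — the integrand may acquire boundary poles, which is allowed here.
* `stub_separatePoles` (Viusos2020 Prop 2.2 / Cor 2.2 inside the rules; size XL — THE HARDEST STUB):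
  a representation with bounded domain is `KZ.Equivalent` to one with bounded domain AND BOUNDED
  INTEGRAND on the domain — embedded resolution of `∂_z S ∪ {P = 0} ∪ {Q = 0}` over `ℚ`; off the
  exceptional divisor (a null set, removable: a null-domain representation is a relation) each blow-up
  chart is a polynomial injective change of variables, and absolute convergence forces the pulled-back
  form to be pole-free on the compact strict transform (Prop 2.2: all exponents `M_i ≥ 0`), hence
  bounded; chart pieces are merged as above. Why it might fail: Hironaka (or at least embedded
  resolution of a hypersurface + boundary over `ℚ`) in Lean is XL; "respects the KZ-rules" is asserted
  only informally in print (Rem. 2.4, Cor. 2.2: charts differ from `S` by Zariski-closed null sets, which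
  must be excised by domain additivity before the chart maps are injective and differentiable WITHIN the piece).
* `stub_graphVolume` (Viusos2020 Cor 2.3; size M): a representation `P = (σ, f)` with `σ ⊆ [-M, M]ᵏ`
  and `|f| ≤ M` on `σ` satisfies `[P] ≡ [K₁] − [K₂] (mod relations)` for two TAME VOLUME FORMS — split
  `σ` by the sign of `f` (domain additivity along the `ℚ`-semialgebraic sets `{f > 0}`, `{f < 0}`,
  `{f = 0}`), `[σ⁻, f] ≡ −[σ⁻, −f]` (integrand additivity with `[σ⁻, 0] ∈ relations`), and one
  Newton–Leibniz move each (`F (x, t) = t`, `a = 0`, `b = |f|`) onto the regions under the graphs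
  `Kᵢ = {(x, t) | x ∈ σ^±, 0 ≤ t ≤ ±f x}` with integrand `1`, which lie in the box `[-M, M]ᵏ⁺¹`.
  Why it might fail: semialgebraicity of `max (f, 0)` / of the sign pieces over `ℚ` and the fibrewise
  regularity side conditions of `newtonLeibnizRel` — routine but unbuilt API.
* `stub_tameMerge` (Viusos2020 §4, first paragraph of the proof of Thm 1.1 — "`ℝalg`-translations such
  that the `Kᵢ` are disjoint"; size M): two tame volume forms of dimensions `m, m' ≤ d` merge into ONE
  tame volume form `A` of dimension `d + 1` with `[A] − [A₁] − [A₂] ∈ relations` — pad both to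
  dimension `d` by unit slabs (tree `KZ.IntegralRep.exists_equivalent_of_le`, tameness is kept: slab
  domain `σ × [0, 1]`, integrand `1 ∘ init`), put them at the disjoint levels `[0, 1]` and `[2, 3]` of
  one more coordinate and glue by domain additivity (tree `exists_of_add_of_sub_of_mem_relations`,
  re-proved with the box bound `max N 3` and `EqOn integrand 1` tracked).
  Why it might fail: nothing mathematical; the tree lemma forgets tameness, so the construction is redone.

Composition (sorry-free, this file): `tameFormsSuffice_of_stubs : <stub₁-sig> → … → <stub₄-sig> →
(TameVolumeKernel → ∀ r r', r.IsRational → r'.IsRational → r.value = r'.value → KZ.Equivalent r r')`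
(the crux UNFOLDED verbatim — `TameFormsSuffice`, `KontsevichZagierPeriods`, `KZPeriodConjecture` are
plain `def`s — so that exactly one theorem of this file, `TameFormsSuffice_of : TameFormsSuffice`,
concludes the crux BY NAME for the A12 audit, and none concludes the summit under unregistered hypotheses):
for rational `r, r'` of equal value, `r ~ R ~ P ≡ [K₁] − [K₂]` and `r' ~ R' ~ P' ≡ [K₁'] − [K₂']`;
merge `A ⊒ K₁ ⊔ K₂'`, `B ⊒ K₂ ⊔ K₁'` in one dimension; soundness of the calculus
(`KZ.relations_le_ker_eval_holds`) gives `vol A = vol B`; `TameVolumeKernel` gives `[A] − [B] ∈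
relations`; and `[r] − [r'] = Σ (the nine relations)` by `abel`.

Disproof used: none exists for this crux (`ledger crux ls stmt-KontsevichZagierPeriods-8990`: no
workfiles; `ledger negatives --problem KontsevichZagierPeriods`: 1 entry, KinematicFormulas plane
convexity, unrelated). No stub is an instance of a landed Negative lemma (there are none under
`Theorems/TameFormsSuffice/`).
-/

namespace Summit.KontsevichZagierPeriods.KontsevichZagierPeriods.Cruxes.TameFormsSuffice.Birth

open Literature.NumberTheory.Transcendental
open Summit.KontsevichZagierPeriods.KontsevichZagierPeriods.Theses.InequalityCost

/-! ## Registered stubs -/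

/-- **Stub 1 — COMPACT DOMAINS INSIDE THE RULES** (Viusos2020 = arXiv:1509.01097, Thm 2.1 / Cor 2.1
"respecting the KZ-rules"): every integral representation is KZ-equivalent to one whose domain lies in
a box `[-N, N]ᵐ` (projective cube charts + inversions `xᵢ ↦ 1/xᵢ` + merging of the chart pieces).
[cite: Viusos2020, Thm 2.1] [cite: KontsevichZagier2001, §1.2] -/
theorem stub_compactDomain : ∀ ⦃n : ℕ⦄ (r : Literature.NumberTheory.Transcendental.KZ.IntegralRep n), ∃ (m N : ℕ) (R : Literature.NumberTheory.Transcendental.KZ.IntegralRep m), (∀ x ∈ R.domain, ∀ i, |x i| ≤ (N : ℝ)) ∧ Literature.NumberTheory.Transcendental.KZ.Equivalent r R := by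
  sorry

/-- **Stub 2 — SEPARATION OF THE BOUNDARY POLES INSIDE THE RULES** (Viusos2020 Prop 2.2 / Cor 2.2;
Hironaka1964; BelkaleBrosnan2003 — the XL stub): a representation with domain in a box is KZ-equivalent
to one with domain in a box AND integrand bounded on the domain (embedded resolution over `ℚ`; blow-up
charts are injective polynomial changes of variables off the null exceptional locus; absolute
convergence ⇒ no pole of the pulled-back form meets the compact strict transform).
[cite: Viusos2020, Prop 2.2] [cite: Hironaka1964] [cite: BelkaleBrosnan2003] -/
theorem stub_separatePoles : ∀ ⦃m : ℕ⦄ (N : ℕ) (R : Literature.NumberTheory.Transcendental.KZ.IntegralRep m), (∀ x ∈ R.domain, ∀ i, |x i| ≤ (N : ℝ)) → ∃ (k M : ℕ) (P : Literature.NumberTheory.Transcendental.KZ.IntegralRep k), (∀ x ∈ P.domain, ∀ i, |x i| ≤ (M : ℝ)) ∧ (∀ x ∈ P.domain, |P.integrand x| ≤ (M : ℝ)) ∧ Literature.NumberTheory.Transcendental.KZ.Equivalent R P := by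
  sorry

/-- **Stub 3 — THE GRAPH TRICK TO VOLUMES** (Viusos2020 Cor 2.3): a representation with domain in the
box `[-M, M]ᵏ` and `|integrand| ≤ M` on the domain is, modulo the KZ relations, a difference
`[K₁] − [K₂]` of two TAME VOLUME FORMS (domains in a box, integrand `1` on the domain): sign splitting by
additivity and one Newton–Leibniz move per sign onto the region under the graph.
[cite: Viusos2020, Cor 2.3] [cite: KontsevichZagier2001, §1.2 rule (3)] -/
theorem stub_graphVolume : ∀ ⦃k : ℕ⦄ (M : ℕ) (P : Literature.NumberTheory.Transcendental.KZ.IntegralRep k), (∀ x ∈ P.domain, ∀ i, |x i| ≤ (M : ℝ)) → (∀ x ∈ P.domain, |P.integrand x| ≤ (M : ℝ)) → ∃ (d M' : ℕ) (K₁ K₂ : Literature.NumberTheory.Transcendental.KZ.IntegralRep d), (∀ x ∈ K₁.domain, ∀ i, |x i| ≤ (M' : ℝ)) ∧ Set.EqOn K₁.integrand 1 K₁.domain ∧ (∀ x ∈ K₂.domain, ∀ i, |x i| ≤ (M' : ℝ)) ∧ Set.EqOn K₂.integrand 1 K₂.domain ∧ Literature.NumberTheory.Transcendental.KZ.of P -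 (Literature.NumberTheory.Transcendental.KZ.of K₁ - Literature.NumberTheory.Transcendental.KZ.of K₂) ∈ Literature.NumberTheory.Transcendental.KZ.relations := by
  sorry

/-- **Stub 4 — TAME MERGING** (Viusos2020 §4, gluing of translates; KZ rules (1), (3)): two tame volume
forms of dimensions `m, m' ≤ d` merge into ONE tame volume form of dimension `d + 1` modulo the
relations (unit slabs up to dimension `d`, disjoint levels `[0,1]` / `[2,3]` of a new last coordinate,
domain additivity) — the tame refinement of tree `KZ.IntegralRep.exists_of_add_of_sub_of_mem_relations`.
[cite: Viusos2020, §4] [cite: KontsevichZagier2001, §1.2 rule (1)] -/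
theorem stub_tameMerge : ∀ ⦃m m' : ℕ⦄ (N d : ℕ) (A₁ : Literature.NumberTheory.Transcendental.KZ.IntegralRep m) (A₂ : Literature.NumberTheory.Transcendental.KZ.IntegralRep m'), m ≤ d → m' ≤ d → (∀ x ∈ A₁.domain, ∀ i, |x i| ≤ (N : ℝ)) → Set.EqOn A₁.integrand 1 A₁.domain → (∀ x ∈ A₂.domain, ∀ i, |x i| ≤ (N : ℝ)) → Set.EqOn A₂.integrand 1 A₂.domain → ∃ (M : ℕ) (A : Literature.NumberTheory.Transcendental.KZ.IntegralRep (d + 1)), (∀ x ∈ A.domain, ∀ i, |x i| ≤ (M : ℝ)) ∧ Set.EqOn A.integrand 1 A.domain ∧ Literature.NumberTheory.Transcendental.KZ.of A - Literature.NumberTheory.Transcendental.KZ.of A₁ - Literature.NumberTheory.Transcendental.KZ.of A₂ ∈ Literature.NumberTheory.Transcendental.KZ.relations := by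
  sorry

/-! ## Composition (sorry-free) -/

/-- Soundness of the calculus, pointwise: a relation evaluates to `0`
(`KZ.relations_le_ker_eval_holds`). [cite: KontsevichZagier2001, §1.2] -/
theorem eval_eq_zero_of_mem_relations {c : KZ.FormalRep} (hc : c ∈ KZ.relations) : KZ.eval c = 0 :=
  AddMonoidHom.mem_ker.1 (KZ.relations_le_ker_eval_holds hc)

/-- The composition, arrow form: COMPACT DOMAIN → SEPARATION OF POLES → GRAPH TRICK → TAME MERGE → the
crux, UNFOLDED verbatim (`TameVolumeKernel →` the two-representation form of Conjecture 1, i.e.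
`KontsevichZagierPeriods` / `Literature.Periods.KZPeriodConjecture` spelled out) so that exactly one
theorem of this file (`TameFormsSuffice_of`) concludes the crux by name. Given rational `r, r'` of equal value:
`r ~ R ~ P ≡ [K₁] − [K₂]`, `r' ~ R' ~ P' ≡ [K₁'] − [K₂']`, merge `A ≡ [K₁] + [K₂']`, `B ≡ [K₂] + [K₁']`
in one dimension, `vol A = vol B` by soundness, `[A] − [B] ∈ relations` by the kernel hypothesis, and
`[r] − [r']` is the signed sum of these nine relations. [cite: Viusos2020, Thm 1.1] [cite: KontsevichZagier2001, §1.2 Conjecture 1] -/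
theorem tameFormsSuffice_of_stubs
    (hC : ∀ ⦃n : ℕ⦄ (r : Literature.NumberTheory.Transcendental.KZ.IntegralRep n), ∃ (m N : ℕ) (R : Literature.NumberTheory.Transcendental.KZ.IntegralRep m), (∀ x ∈ R.domain, ∀ i, |x i| ≤ (N : ℝ)) ∧ Literature.NumberTheory.Transcendental.KZ.Equivalent r R)
    (hS : ∀ ⦃m : ℕ⦄ (N : ℕ) (R : Literature.NumberTheory.Transcendental.KZ.IntegralRep m), (∀ x ∈ R.domain, ∀ i, |x i| ≤ (N : ℝ)) → ∃ (k M : ℕ) (P : Literature.NumberTheory.Transcendental.KZ.IntegralRep k), (∀ x ∈ P.domain, ∀ i, |x i| ≤ (M : ℝ)) ∧ (∀ x ∈ P.domain, |P.integrand x| ≤ (M : ℝ)) ∧ Literature.NumberTheory.Transcendental.KZ.Equivalent R P)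
    (hG : ∀ ⦃k : ℕ⦄ (M : ℕ) (P : Literature.NumberTheory.Transcendental.KZ.IntegralRep k), (∀ x ∈ P.domain, ∀ i, |x i| ≤ (M : ℝ)) → (∀ x ∈ P.domain, |P.integrand x| ≤ (M : ℝ)) → ∃ (d M' : ℕ) (K₁ K₂ : Literature.NumberTheory.Transcendental.KZ.IntegralRep d), (∀ x ∈ K₁.domain, ∀ i, |x i| ≤ (M' : ℝ)) ∧ Set.EqOn K₁.integrand 1 K₁.domain ∧ (∀ x ∈ K₂.domain, ∀ i, |x i| ≤ (M' : ℝ)) ∧ Set.EqOn K₂.integrand 1 K₂.domain ∧ Literature.NumberTheory.Transcendental.KZ.of P - (Literature.NumberTheory.Transcendental.KZ.of K₁ - Literature.NumberTheory.Transcendental.KZ.of K₂) ∈ Literature.NumberTheory.Transcendental.KZ.relations)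
    (hM : ∀ ⦃m m' : ℕ⦄ (N d : ℕ) (A₁ : Literature.NumberTheory.Transcendental.KZ.IntegralRep m) (A₂ : Literature.NumberTheory.Transcendental.KZ.IntegralRep m'), m ≤ d → m' ≤ d → (∀ x ∈ A₁.domain, ∀ i, |x i| ≤ (N : ℝ)) → Set.EqOn A₁.integrand 1 A₁.domain → (∀ x ∈ A₂.domain, ∀ i, |x i| ≤ (N : ℝ)) → Set.EqOn A₂.integrand 1 A₂.domain → ∃ (M : ℕ) (A : Literature.NumberTheory.Transcendental.KZ.IntegralRep (d + 1)), (∀ x ∈ A.domain, ∀ i, |x i| ≤ (M : ℝ)) ∧ Set.EqOn A.integrand 1 A.domain ∧ Literature.NumberTheory.Transcendental.KZ.of A - Literature.NumberTheory.Transcendental.KZ.of A₁ - Literature.NumberTheory.Transcendental.KZ.of A₂ ∈ Literature.NumberTheory.Transcendental.KZ.relations) :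
    TameVolumeKernel → ∀ ⦃n m : ℕ⦄ (r : Literature.NumberTheory.Transcendental.KZ.IntegralRep n) (r' : Literature.NumberTheory.Transcendental.KZ.IntegralRep m), r.IsRational → r'.IsRational → r.value = r'.value → Literature.NumberTheory.Transcendental.KZ.Equivalent r r' := by
  intro hT n n' r r' _hr _hr' hv
  -- Viu-Sos' reduction of `r` and of `r'`
  obtain ⟨m, N, R, hRb, hrR⟩ := hC r
  obtain ⟨m', N', R', hRb', hrR'⟩ := hC r'
  obtain ⟨k, M, P, hPb, hPi, hRP⟩ := hS N R hRb
  obtain ⟨k', M', P', hPb', hPi', hRP'⟩ := hS N' R' hRb'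
  obtain ⟨d, L, K₁, K₂, hK₁b, hK₁i, hK₂b, hK₂i, hPK⟩ := hG M P hPb hPi
  obtain ⟨d', L', K₁', K₂', hK₁b', hK₁i', hK₂b', hK₂i', hPK'⟩ := hG M' P' hPb' hPi'
  -- a common box for the four tame volume forms
  have hK₁c : ∀ x ∈ K₁.domain, ∀ i, |x i| ≤ ((max L L' : ℕ) : ℝ) := fun x hx i =>
    (hK₁b x hx i).trans (by exact_mod_cast le_max_left L L')
  have hK₂c : ∀ x ∈ K₂.domain, ∀ i, |x i| ≤ ((max L L' : ℕ) : ℝ) := fun x hx i =>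
    (hK₂b x hx i).trans (by exact_mod_cast le_max_left L L')
  have hK₁c' : ∀ x ∈ K₁'.domain, ∀ i, |x i| ≤ ((max L L' : ℕ) : ℝ) := fun x hx i =>
    (hK₁b' x hx i).trans (by exact_mod_cast le_max_right L L')
  have hK₂c' : ∀ x ∈ K₂'.domain, ∀ i, |x i| ≤ ((max L L' : ℕ) : ℝ) := fun x hx i =>
    (hK₂b' x hx i).trans (by exact_mod_cast le_max_right L L')
  -- merge `K₁ ⊔ K₂'` and `K₂ ⊔ K₁'` in the common dimension `max d d' + 1`
  obtain ⟨MA, A, hAb, hAi, hA⟩ := hM (max L L') (max d d') K₁ K₂' (le_max_left d d') (le_max_right d d') hK₁c hK₁i hK₂c' hK₂i'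
  obtain ⟨MB, B, hBb, hBi, hB⟩ := hM (max L L') (max d d') K₂ K₁' (le_max_left d d') (le_max_right d d') hK₂c hK₂i hK₁c' hK₁i'
  -- values, by soundness of the calculus
  have e₁ := eval_eq_zero_of_mem_relations hrR
  have e₂ := eval_eq_zero_of_mem_relations hRP
  have e₃ := eval_eq_zero_of_mem_relations hPK
  have e₁' := eval_eq_zero_of_mem_relations hrR'
  have e₂' := eval_eq_zero_of_mem_relations hRP'
  have e₃' := eval_eq_zero_of_mem_relations hPK'
  have eA := eval_eq_zero_of_mem_relations hA
  have eB := eval_eq_zero_of_mem_relations hB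
  simp only [map_sub, KZ.eval_of] at e₁ e₂ e₃ e₁' e₂' e₃' eA eB
  have hAB : A.value = B.value := by linarith
  -- the kernel hypothesis, once
  have hABb : ∀ x ∈ A.domain, ∀ i, |x i| ≤ ((max MA MB : ℕ) : ℝ) := fun x hx i =>
    (hAb x hx i).trans (by exact_mod_cast le_max_left MA MB)
  have hBAb : ∀ x ∈ B.domain, ∀ i, |x i| ≤ ((max MA MB : ℕ) : ℝ) := fun x hx i =>
    (hBb x hx i).trans (by exact_mod_cast le_max_right MA MB)
  have hKer : KZ.Equivalent A B := hT (max MA MB) A B hABb hAi hBAb hBi hAB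
  -- bookkeeping in the formal group
  have key : KZ.of r - KZ.of r' =
      (KZ.of r - KZ.of R) + (KZ.of R - KZ.of P) + (KZ.of P - (KZ.of K₁ - KZ.of K₂))
        - (KZ.of A - KZ.of K₁ - KZ.of K₂') + (KZ.of A - KZ.of B) + (KZ.of B - KZ.of K₂ - KZ.of K₁')
        - (KZ.of P' - (KZ.of K₁' - KZ.of K₂')) - (KZ.of R' - KZ.of P') - (KZ.of r' - KZ.of R') := by
    abel
  show KZ.of r - KZ.of r' ∈ KZ.relations
  rw [key]
  refine KZ.relations.sub_mem (KZ.relations.sub_mem (KZ.relations.sub_mem (KZ.relations.add_mem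
    (KZ.relations.add_mem (KZ.relations.sub_mem (KZ.relations.add_mem (KZ.relations.add_mem hrR hRP)
    hPK) hA) hKer) hB) hPK') hRP') hrR'

/-- **The skeleton theorem** (concludes the crux BY NAME; `sorry` enters only through the four named
stubs): `TameFormsSuffice` from COMPACT DOMAIN, SEPARATION OF POLES, GRAPH TRICK and TAME MERGE.
[cite: Viusos2020, Thm 1.1] [cite: KontsevichZagier2001, §1.2 Conjecture 1] -/
theorem TameFormsSuffice_of : TameFormsSuffice :=
  tameFormsSuffice_of_stubs stub_compactDomain stub_separatePoles stub_graphVolume stub_tameMerge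

end Summit.KontsevichZagierPeriods.KontsevichZagierPeriods.Cruxes.TameFormsSuffice.Birth
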